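import Summits.CriticalPhenomena.PercolationContinuityZ3.Theorems.PercAnnulusCrossingIICErgodicPairs
import HarnessLib

/-!
# Weak law of large numbers for the IIC: the empirical density of any local pattern in `Λ(n)` → `P_{p_c}(E)` in probability (lane RSW3, p1 gen 7)

builds on p205010 (kernel theorem, internal audit signed; external expert review pending) — used only through the (A2)□ ⇒ one-arm
quasi-multiplicativity bridge and `CSH.percolationContinuity_allDimensions` (the `p_c(ℤ^d)` statement); the `ℤ²` statement is unconditional.

Seat `prim-rsw3-p1` (gen 7).  Chebyshev on top of `PercAnnulusCrossingIICErgodic{,Pairs}.lean`: for a cylinder event `E`, Kesten's IIC measure `ν`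
and `N_n(ω) = #{x ∈ Λ(n) : ω + x ∈ E}`, the first two moments `E_ν N_n = Σ_x ν(S_x)` and `E_ν N_n² = Σ_{x,y} ν(S_x ∩ S_y)`
(`integral_sq_card_filter_sub`) and the two Cesàro limits give `E_ν (N_n − |Λ(n)| P)² = o(|Λ(n)|²)`, whence

* `tendsto_integral_sq_density_sub_of_moments`, `tendsto_measureReal_deviation_of_moments` — the abstract `L²` / Chebyshev steps for any family of measurable events `S_x` under a probability
  measure: first and second Cesàro moments `→ P`, `P²` imply `ν(|N_n − |Λ(n)|P| ≥ η|Λ(n)|) → 0` for every `η > 0`;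
* **`iicMeasure_tendsto_integral_sq_density_sub_criticalProbI` / `_Z2`** — `∫ (A_n − P_{p_c}(E))² dν → 0` (`L²`-ergodic theorem);
* **`iicMeasure_tendsto_real_density_deviation_criticalProbI`** — at `p_c(ℤ^d)`, `d ≥ 2`, under (A2)□ at one aspect, for every probability
  measure `ν` with Kesten's IIC limit property, every cylinder event `E` and every `η > 0`:
  **`ν({ω : |#{x ∈ Λ(n) : ω + x ∈ E} − |Λ(n)|·P_{p_c}(E)| ≥ η·|Λ(n)|}) → 0`** — THE WEAK LAW OF LARGE NUMBERS FOR LOCAL PATTERNS UNDER THE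
  INCIPIENT INFINITE CLUSTER, with the critical Bernoulli frequencies as limits; `…_Z2` — the same on `ℤ²`, unconditionally.
Corollaries (edge density `p_c`; every pattern of positive probability occurs infinitely often) are in `PercAnnulusCrossingIICErgodicPatterns.lean`.

Helper file for the crux `stmt-CriticalPhenomena-4575` chain; no definitions, no sorries.
References: H. Kesten, PTRF 73 (1986) 369–394, Thm. (3), (1.12)–(1.13); G. Grimmett, *Percolation* (1999), §2.2.
-/

noncomputable section

namespace Summit.CriticalPhenomena.PercolationContinuityZ3.Theorems.Crossing

open MeasureTheory ProbabilityTheory Filter Topology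
open Literature.Probability.Percolation Literature.Probability.LatticeModels
open Literature.Probability.Percolation.DCT16
open scoped ENNReal ProbabilityTheory Literature.Probability.Percolation

variable {d : ℕ}

/-! ## The counting variable and its first two moments -/

open Classical in
/-- The count `#{x ∈ Λ(n) : ω ∈ S_x}` is the sum of the indicators. [folklore] -/
theorem card_filter_mem_eq_sum_indicator (S : Site d → Set (BondConfig (Site d))) (n : ℕ) (ω : BondConfig (Site d)) :
    ((((box d n).filter fun x => ω ∈ S x).card : ℕ) : ℝ) = ∑ x ∈ box d n, (S x).indicator 1 ω := by
  classical
  rw [Finset.card_filter]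
  push_cast
  refine Finset.sum_congr rfl fun x _ => ?_
  by_cases h : ω ∈ S x
  · simp [h]
  · simp [h]

open Classical in
/-- **Second moment of the count**: for measurable events `S_x` under a probability measure `ν` and any constant `a`,
`∫ (#{x ∈ Λ(n) : ω ∈ S_x} − a)² dν = Σ_{x,y ∈ Λ(n)} ν(S_x ∩ S_y) − 2a·Σ_{x ∈ Λ(n)} ν(S_x) + a²`. [folklore] -/
theorem integral_sq_card_filter_sub {ν : Measure (BondConfig (Site d))} [IsProbabilityMeasure ν]
    (S : Site d → Set (BondConfig (Site d))) (hS : ∀ x, MeasurableSet (S x)) (n : ℕ) (a : ℝ) :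
    ∫ ω, (((((box d n).filter fun x => ω ∈ S x).card : ℕ) : ℝ) - a) ^ 2 ∂ν =
      ∑ x ∈ box d n, ∑ y ∈ box d n, ν.real (S x ∩ S y) - 2 * a * ∑ x ∈ box d n, ν.real (S x) + a ^ 2 := by
  classical
  -- pointwise expansion
  have hpt : ∀ ω : BondConfig (Site d), (((((box d n).filter fun x => ω ∈ S x).card : ℕ) : ℝ) - a) ^ 2 =
      ∑ x ∈ box d n, ∑ y ∈ box d n, (S x ∩ S y).indicator 1 ω - 2 * a * ∑ x ∈ box d n, (S x).indicator 1 ω + a ^ 2 := by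
    intro ω
    rw [card_filter_mem_eq_sum_indicator S n ω]
    have hsq : (∑ x ∈ box d n, (S x).indicator (1 : BondConfig (Site d) → ℝ) ω) ^ 2 =
        ∑ x ∈ box d n, ∑ y ∈ box d n, (S x ∩ S y).indicator 1 ω := by
      rw [sq, Finset.sum_mul_sum]
      refine Finset.sum_congr rfl fun x _ => Finset.sum_congr rfl fun y _ => ?_
      rw [Set.inter_indicator_one]
      rfl
    rw [← hsq]
    ring
  -- integrability of the pieces
  have hint1 : ∀ x, Integrable (fun ω => (S x).indicator (1 : BondConfig (Site d) → ℝ) ω) ν := fun x =>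
    Integrable.of_bound ((measurable_one.indicator (hS x)).aestronglyMeasurable) 1
      (Eventually.of_forall fun ω => by
        rw [Real.norm_eq_abs, Set.indicator_apply]
        split_ifs <;> simp)
  have hint2 : ∀ x y, Integrable (fun ω => (S x ∩ S y).indicator (1 : BondConfig (Site d) → ℝ) ω) ν := fun x y =>
    Integrable.of_bound ((measurable_one.indicator ((hS x).inter (hS y))).aestronglyMeasurable) 1
      (Eventually.of_forall fun ω => by
        rw [Real.norm_eq_abs, Set.indicator_apply]
        split_ifs <;> simp)
  have hintS1 : Integrable (fun ω => ∑ x ∈ box d n, (S x).indicator (1 : BondConfig (Site d) → ℝ) ω) ν :=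
    integrable_finsetSum _ fun x _ => hint1 x
  have hintS2 : Integrable (fun ω => ∑ x ∈ box d n, ∑ y ∈ box d n, (S x ∩ S y).indicator (1 : BondConfig (Site d) → ℝ) ω) ν :=
    integrable_finsetSum _ fun x _ => integrable_finsetSum _ fun y _ => hint2 x y
  -- integrate
  have hI1 : Integrable (fun ω => ∑ x ∈ box d n, ∑ y ∈ box d n, (S x ∩ S y).indicator (1 : BondConfig (Site d) → ℝ) ω -
      2 * a * ∑ x ∈ box d n, (S x).indicator (1 : BondConfig (Site d) → ℝ) ω) ν := hintS2.sub (hintS1.const_mul (2 * a))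
  have hI2 : Integrable (fun ω => 2 * a * ∑ x ∈ box d n, (S x).indicator (1 : BondConfig (Site d) → ℝ) ω) ν :=
    hintS1.const_mul (2 * a)
  have hI3 : ∫ _ : BondConfig (Site d), a ^ 2 ∂ν = a ^ 2 := by simp
  have hA : ∫ ω, ∑ x ∈ box d n, ∑ y ∈ box d n, (S x ∩ S y).indicator (1 : BondConfig (Site d) → ℝ) ω ∂ν =
      ∑ x ∈ box d n, ∑ y ∈ box d n, ν.real (S x ∩ S y) := by
    rw [integral_finsetSum _ fun x _ => integrable_finsetSum _ fun y _ => hint2 x y]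
    refine Finset.sum_congr rfl fun x _ => ?_
    rw [integral_finsetSum _ fun y _ => hint2 x y]
    exact Finset.sum_congr rfl fun y _ => integral_indicator_one ((hS x).inter (hS y))
  have hB : ∫ ω, ∑ x ∈ box d n, (S x).indicator (1 : BondConfig (Site d) → ℝ) ω ∂ν = ∑ x ∈ box d n, ν.real (S x) := by
    rw [integral_finsetSum _ fun x _ => hint1 x]
    exact Finset.sum_congr rfl fun x _ => integral_indicator_one (hS x)
  rw [integral_congr_ae (Eventually.of_forall hpt), integral_add hI1 (integrable_const _), integral_sub hintS2 hI2,
    integral_const_mul, hI3, hA, hB]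

/-! ## Chebyshev -/

open Classical in
/-- **From two Cesàro moments to the weak law**: for measurable events `S_x` under a probability measure `ν` on configurations of `ℤ^d`
(`d ≥ 1`), if `|Λ(n)|⁻¹ Σ_x ν(S_x) → P` and `|Λ(n)|⁻² Σ_{x,y} ν(S_x ∩ S_y) → P²`, then for every `η > 0`,
`ν({ω : η·|Λ(n)| ≤ |#{x ∈ Λ(n) : ω ∈ S_x} − |Λ(n)|·P|}) → 0` (Chebyshev: the variance is `o(|Λ(n)|²)`). [folklore] -/
theorem tendsto_measureReal_deviation_of_moments (hd : 1 ≤ d) {ν : Measure (BondConfig (Site d))} [IsProbabilityMeasure ν]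
    (S : Site d → Set (BondConfig (Site d))) (hS : ∀ x, MeasurableSet (S x)) {P : ℝ}
    (h1 : Tendsto (fun n : ℕ => (∑ x ∈ box d n, ν.real (S x)) / ((box d n).card : ℝ)) atTop (𝓝 P))
    (h2 : Tendsto (fun n : ℕ => (∑ x ∈ box d n, ∑ y ∈ box d n, ν.real (S x ∩ S y)) / ((box d n).card : ℝ) ^ 2) atTop (𝓝 (P ^ 2)))
    {η : ℝ} (hη : 0 < η) :
    Tendsto (fun n : ℕ => ν.real {ω | η * (box d n).card ≤
        |((((box d n).filter fun x => ω ∈ S x).card : ℕ) : ℝ) - (box d n).card * P|}) atTop (𝓝 0) := by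
  classical
  -- the normalised variance tends to `0`
  have hvar : Tendsto (fun n : ℕ => ((∑ x ∈ box d n, ∑ y ∈ box d n, ν.real (S x ∩ S y)) / ((box d n).card : ℝ) ^ 2 -
      2 * P * ((∑ x ∈ box d n, ν.real (S x)) / ((box d n).card : ℝ)) + P ^ 2) / η ^ 2) atTop (𝓝 0) := by
    have h := ((h2.sub (h1.const_mul (2 * P))).add tendsto_const_nhds (b := P ^ 2)).div_const (η ^ 2)
    rw [show (P ^ 2 - 2 * P * P + P ^ 2) / η ^ 2 = 0 by ring] at h
    exact h
  have hcard := tendsto_card_box_atTop hd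
  have hpos : ∀ᶠ n : ℕ in atTop, (0 : ℝ) < (box d n).card := hcard.eventually (eventually_gt_atTop 0)
  refine tendsto_of_tendsto_of_tendsto_of_le_of_le' tendsto_const_nhds hvar (Eventually.of_forall fun n => measureReal_nonneg) ?_
  filter_upwards [hpos] with n hn
  set c : ℝ := ((box d n).card : ℝ) with hc
  -- Chebyshev
  have hcheb := mul_meas_ge_le_integral_of_nonneg (μ := ν)
    (f := fun ω => (((((box d n).filter fun x => ω ∈ S x).card : ℕ) : ℝ) - c * P) ^ 2)
    (Eventually.of_forall fun ω => sq_nonneg _) ?_ ((η * c) ^ 2)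
  · rw [integral_sq_card_filter_sub S hS n (c * P)] at hcheb
    have hsub : {ω : BondConfig (Site d) | η * c ≤ |((((box d n).filter fun x => ω ∈ S x).card : ℕ) : ℝ) - c * P|} ⊆
        {ω | (η * c) ^ 2 ≤ (((((box d n).filter fun x => ω ∈ S x).card : ℕ) : ℝ) - c * P) ^ 2} := by
      intro ω hω
      have hω' : η * c ≤ |((((box d n).filter fun x => ω ∈ S x).card : ℕ) : ℝ) - c * P| := hω
      have h0 : 0 ≤ η * c := by positivity
      calc (η * c) ^ 2 ≤ |((((box d n).filter fun x => ω ∈ S x).card : ℕ) : ℝ) - c * P| ^ 2 := pow_le_pow_left₀ h0 hω' 2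
        _ = _ := sq_abs _
    have hηc : 0 < (η * c) ^ 2 := by positivity
    have hle : ν.real {ω | η * c ≤ |((((box d n).filter fun x => ω ∈ S x).card : ℕ) : ℝ) - c * P|} ≤
        (∑ x ∈ box d n, ∑ y ∈ box d n, ν.real (S x ∩ S y) - 2 * (c * P) * ∑ x ∈ box d n, ν.real (S x) + (c * P) ^ 2) /
          (η * c) ^ 2 := by
      rw [le_div_iff₀ hηc, mul_comm]
      exact (mul_le_mul_of_nonneg_left (measureReal_mono hsub (measure_ne_top _ _)) hηc.le).trans hcheb
    refine hle.trans (le_of_eq ?_)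
    have hc0 : c ≠ 0 := hn.ne'
    have hη0 : η ≠ 0 := hη.ne'
    rw [div_eq_div_iff hηc.ne' (pow_ne_zero 2 hη0)]
    field_simp
  · -- integrability of the square (bounded measurable function on a probability space)
    have hmeas : Measurable fun ω : BondConfig (Site d) => ((((box d n).filter fun x => ω ∈ S x).card : ℕ) : ℝ) := by
      have h : (fun ω : BondConfig (Site d) => ((((box d n).filter fun x => ω ∈ S x).card : ℕ) : ℝ)) =
          fun ω => ∑ x ∈ box d n, (S x).indicator 1 ω := funext fun ω => card_filter_mem_eq_sum_indicator S n ω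
      rw [h]
      exact Finset.measurable_sum _ fun x _ => measurable_one.indicator (hS x)
    refine Integrable.of_bound ((hmeas.sub_const _).pow_const 2).aestronglyMeasurable ((c + |c * P|) ^ 2)
      (Eventually.of_forall fun ω => ?_)
    have hN : ((((box d n).filter fun x => ω ∈ S x).card : ℕ) : ℝ) ≤ c := by
      rw [hc]; exact_mod_cast Finset.card_filter_le _ _
    have hN0 : 0 ≤ ((((box d n).filter fun x => ω ∈ S x).card : ℕ) : ℝ) := Nat.cast_nonneg _
    rw [Real.norm_eq_abs, abs_pow, pow_le_pow_iff_left₀ (abs_nonneg _) (by positivity) two_ne_zero]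
    calc |((((box d n).filter fun x => ω ∈ S x).card : ℕ) : ℝ) - c * P|
        ≤ |((((box d n).filter fun x => ω ∈ S x).card : ℕ) : ℝ)| + |c * P| := abs_sub _ _
      _ ≤ c + |c * P| := by rw [abs_of_nonneg hN0]; linarith

open Classical in
/-- **`L²`-ergodic theorem from two Cesàro moments**: under the hypotheses of `tendsto_measureReal_deviation_of_moments`,
`∫ (#{x ∈ Λ(n) : ω ∈ S_x}/|Λ(n)| − P)² dν → 0`. [folklore] -/
theorem tendsto_integral_sq_density_sub_of_moments {ν : Measure (BondConfig (Site d))} [IsProbabilityMeasure ν]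
    (S : Site d → Set (BondConfig (Site d))) (hS : ∀ x, MeasurableSet (S x)) {P : ℝ}
    (h1 : Tendsto (fun n : ℕ => (∑ x ∈ box d n, ν.real (S x)) / ((box d n).card : ℝ)) atTop (𝓝 P))
    (h2 : Tendsto (fun n : ℕ => (∑ x ∈ box d n, ∑ y ∈ box d n, ν.real (S x ∩ S y)) / ((box d n).card : ℝ) ^ 2) atTop (𝓝 (P ^ 2))) :
    Tendsto (fun n : ℕ => ∫ ω, (((((box d n).filter fun x => ω ∈ S x).card : ℕ) : ℝ) / (box d n).card - P) ^ 2 ∂ν) atTop (𝓝 0) := by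
  classical
  have hvar : Tendsto (fun n : ℕ => (∑ x ∈ box d n, ∑ y ∈ box d n, ν.real (S x ∩ S y)) / ((box d n).card : ℝ) ^ 2 -
      2 * P * ((∑ x ∈ box d n, ν.real (S x)) / ((box d n).card : ℝ)) + P ^ 2) atTop (𝓝 0) := by
    have h := (h2.sub (h1.const_mul (2 * P))).add tendsto_const_nhds (b := P ^ 2)
    rw [show P ^ 2 - 2 * P * P + P ^ 2 = 0 by ring] at h
    exact h
  refine hvar.congr fun n => ?_
  have hc : (0 : ℝ) < (box d n).card := by exact_mod_cast (box_nonempty d n).card_pos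
  set c : ℝ := ((box d n).card : ℝ) with hcdef
  have hpt : ∀ ω : BondConfig (Site d), (((((box d n).filter fun x => ω ∈ S x).card : ℕ) : ℝ) / c - P) ^ 2 =
      (((((box d n).filter fun x => ω ∈ S x).card : ℕ) : ℝ) - c * P) ^ 2 / c ^ 2 := fun ω => by
    field_simp
  rw [integral_congr_ae (Eventually.of_forall hpt), integral_div, integral_sq_card_filter_sub S hS n (c * P)]
  field_simp

/-! ## The weak law under the IIC -/

/-- Measurability of the translate `{ω | ω + x ∈ E}` of a cylinder event. [folklore] -/
theorem measurableSet_preimage_relabel_shift {F : Finset (Sym2 (Site d))} {E : Set (BondConfig (Site d))}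
    (hE : DeterminedBy E (↑F : Set (Sym2 (Site d)))) (x : Site d) :
    MeasurableSet (BondConfig.relabel (sym2Equiv (Site.shift x)) ⁻¹' E) := by
  classical
  exact (determinedBy_preimage_relabel_shift hE x).measurableSet_of_finset

open Classical in
/-- **WEAK LAW OF LARGE NUMBERS FOR LOCAL PATTERNS UNDER THE IIC (ℤ^d, under (A2)□)**: at `p_c(ℤ^d)`, `d ≥ 2`, under (A2)□ at aspect
`(s,L)`, for every probability measure `ν` with Kesten's IIC limit property, every cylinder event `E` and every `η > 0`:
**`ν({ω : |#{x ∈ Λ(n) : ω + x ∈ E} − |Λ(n)|·P_{p_c}(E)| ≥ η·|Λ(n)|}) → 0`** — in a `ν`-typical configuration the pattern `E` occurs around a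
proportion `P_{p_c}(E) + o(1)` of the sites of `Λ(n)`: seen through local statistics of large boxes, the incipient infinite cluster is
indistinguishable from critical percolation. [cite: Kesten1986, Thm. (3), (1.12)–(1.13)] [cite: BasuSapozhnikov2017ECP, Thm. 1.1 and §1 (A2)] -/
theorem iicMeasure_tendsto_real_density_deviation_criticalProbI (hd : 2 ≤ d) {s L : ℕ} (hs : 2 ≤ s) (hsL : s ≤ L) {ϰ : ℝ}
    (hϰ : 0 < ϰ) (hA2 : SetToSetQuasiMultAspectAt d (criticalProbI d) s L ϰ) {ν : Measure (BondConfig (Site d))}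
    [IsProbabilityMeasure ν]
    (hν : ∀ (F : Finset (Sym2 (Site d))) (E : Set (BondConfig (Site d))), MeasurableSet E → DeterminedBy E ↑F →
      Tendsto (fun n : ℕ => (bondPercolation (zdGraph d) (criticalProbI d)).real (E ∩ siteToBoundary d n) /
        oneArmProb d (criticalProbI d) n) atTop (𝓝 (ν.real E)))
    {F : Finset (Sym2 (Site d))} {E : Set (BondConfig (Site d))} (hE : DeterminedBy E (↑F : Set (Sym2 (Site d))))
    {η : ℝ} (hη : 0 < η) :
    Tendsto (fun n : ℕ => ν.real {ω | η * (box d n).card ≤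
        |((((box d n).filter fun x => BondConfig.relabel (sym2Equiv (Site.shift x)) ω ∈ E).card : ℕ) : ℝ) -
          (box d n).card * (bondPercolation (zdGraph d) (criticalProbI d)).real E|}) atTop (𝓝 0) :=
  tendsto_measureReal_deviation_of_moments (by omega) (fun x => BondConfig.relabel (sym2Equiv (Site.shift x)) ⁻¹' E)
    (measurableSet_preimage_relabel_shift hE)
    (iicMeasure_tendsto_boxAverage_real_preimage_shift_criticalProbI hd hs hsL hϰ hA2 hν hE)
    (iicMeasure_tendsto_boxPairAverage_real_preimage_shift_criticalProbI hd hs hsL hϰ hA2 hν hE) hη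

open Classical in
/-- **WEAK LAW OF LARGE NUMBERS FOR LOCAL PATTERNS UNDER THE PLANAR IIC, unconditionally**: for every probability measure `ν` with Kesten's
IIC limit property at `p_c(ℤ²) = 1/2`, every cylinder event `E` and every `η > 0`:
**`ν({ω : |#{x ∈ Λ(n) : ω + x ∈ E} − |Λ(n)|·P_{1/2}(E)| ≥ η·|Λ(n)|}) → 0`**. [cite: Kesten1986, Thm. (3), (1.12)–(1.13)] -/
theorem iicMeasure_tendsto_real_density_deviation_Z2 {ν : Measure (BondConfig (Site 2))} [IsProbabilityMeasure ν]
    (hν : ∀ (F : Finset (Sym2 (Site 2))) (E : Set (BondConfig (Site 2))), MeasurableSet E → DeterminedBy E ↑F →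
      Tendsto (fun n : ℕ => (bondPercolation (zdGraph 2) (criticalProbI 2)).real (E ∩ siteToBoundary 2 n) /
        oneArmProb 2 (criticalProbI 2) n) atTop (𝓝 (ν.real E)))
    {F : Finset (Sym2 (Site 2))} {E : Set (BondConfig (Site 2))} (hE : DeterminedBy E (↑F : Set (Sym2 (Site 2))))
    {η : ℝ} (hη : 0 < η) :
    Tendsto (fun n : ℕ => ν.real {ω | η * (box 2 n).card ≤
        |((((box 2 n).filter fun x => BondConfig.relabel (sym2Equiv (Site.shift x)) ω ∈ E).card : ℕ) : ℝ) -
          (box 2 n).card * (bondPercolation (zdGraph 2) (criticalProbI 2)).real E|}) atTop (𝓝 0) :=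
  tendsto_measureReal_deviation_of_moments (d := 2) (by norm_num) (fun x => BondConfig.relabel (sym2Equiv (Site.shift x)) ⁻¹' E)
    (measurableSet_preimage_relabel_shift hE)
    (iicMeasure_tendsto_boxAverage_real_preimage_shift_Z2 hν hE)
    (iicMeasure_tendsto_boxPairAverage_real_preimage_shift_Z2 hν hE) hη

open Classical in
/-- **`L²`-ERGODIC THEOREM FOR THE IIC (ℤ^d, under (A2)□)**: at `p_c(ℤ^d)`, `d ≥ 2`, under (A2)□ at one aspect, for every probability measure `ν` with
Kesten's IIC limit property and every cylinder event `E`: **`∫ (#{x ∈ Λ(n) : ω + x ∈ E}/|Λ(n)| − P_{p_c}(E))² dν(ω) → 0`** — the empirical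
density of the pattern `E` converges to its critical probability in `L²(ν)`. [cite: Kesten1986, Thm. (3), (1.12)–(1.13)]
[cite: BasuSapozhnikov2017ECP, Thm. 1.1 and §1 (A2)] -/
theorem iicMeasure_tendsto_integral_sq_density_sub_criticalProbI (hd : 2 ≤ d) {s L : ℕ} (hs : 2 ≤ s) (hsL : s ≤ L) {ϰ : ℝ}
    (hϰ : 0 < ϰ) (hA2 : SetToSetQuasiMultAspectAt d (criticalProbI d) s L ϰ) {ν : Measure (BondConfig (Site d))}
    [IsProbabilityMeasure ν]
    (hν : ∀ (F : Finset (Sym2 (Site d))) (E : Set (BondConfig (Site d))), MeasurableSet E → DeterminedBy E ↑F →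
      Tendsto (fun n : ℕ => (bondPercolation (zdGraph d) (criticalProbI d)).real (E ∩ siteToBoundary d n) /
        oneArmProb d (criticalProbI d) n) atTop (𝓝 (ν.real E)))
    {F : Finset (Sym2 (Site d))} {E : Set (BondConfig (Site d))} (hE : DeterminedBy E (↑F : Set (Sym2 (Site d)))) :
    Tendsto (fun n : ℕ => ∫ ω, (((((box d n).filter fun x => BondConfig.relabel (sym2Equiv (Site.shift x)) ω ∈ E).card : ℕ) : ℝ) /
        (box d n).card - (bondPercolation (zdGraph d) (criticalProbI d)).real E) ^ 2 ∂ν) atTop (𝓝 0) :=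
  tendsto_integral_sq_density_sub_of_moments (fun x => BondConfig.relabel (sym2Equiv (Site.shift x)) ⁻¹' E)
    (measurableSet_preimage_relabel_shift hE)
    (iicMeasure_tendsto_boxAverage_real_preimage_shift_criticalProbI hd hs hsL hϰ hA2 hν hE)
    (iicMeasure_tendsto_boxPairAverage_real_preimage_shift_criticalProbI hd hs hsL hϰ hA2 hν hE)

open Classical in
/-- **`L²`-ERGODIC THEOREM FOR THE PLANAR IIC, unconditionally**: for every probability measure `ν` with Kesten's IIC limit property at
`p_c(ℤ²)` and every cylinder event `E`: `∫ (#{x ∈ Λ(n) : ω + x ∈ E}/|Λ(n)| − P_{1/2}(E))² dν(ω) → 0`. [cite: Kesten1986, Thm. (3), (1.12)–(1.13)] -/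
theorem iicMeasure_tendsto_integral_sq_density_sub_Z2 {ν : Measure (BondConfig (Site 2))} [IsProbabilityMeasure ν]
    (hν : ∀ (F : Finset (Sym2 (Site 2))) (E : Set (BondConfig (Site 2))), MeasurableSet E → DeterminedBy E ↑F →
      Tendsto (fun n : ℕ => (bondPercolation (zdGraph 2) (criticalProbI 2)).real (E ∩ siteToBoundary 2 n) /
        oneArmProb 2 (criticalProbI 2) n) atTop (𝓝 (ν.real E)))
    {F : Finset (Sym2 (Site 2))} {E : Set (BondConfig (Site 2))} (hE : DeterminedBy E (↑F : Set (Sym2 (Site 2)))) :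
    Tendsto (fun n : ℕ => ∫ ω, (((((box 2 n).filter fun x => BondConfig.relabel (sym2Equiv (Site.shift x)) ω ∈ E).card : ℕ) : ℝ) /
        (box 2 n).card - (bondPercolation (zdGraph 2) (criticalProbI 2)).real E) ^ 2 ∂ν) atTop (𝓝 0) :=
  tendsto_integral_sq_density_sub_of_moments (d := 2) (fun x => BondConfig.relabel (sym2Equiv (Site.shift x)) ⁻¹' E)
    (measurableSet_preimage_relabel_shift hE)
    (iicMeasure_tendsto_boxAverage_real_preimage_shift_Z2 hν hE)
    (iicMeasure_tendsto_boxPairAverage_real_preimage_shift_Z2 hν hE)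

end Summit.CriticalPhenomena.PercolationContinuityZ3.Theorems.Crossing

end
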